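import Summits.KontsevichZagierPeriods.KontsevichZagierPeriods.Theorems.NormalFormPrinciple.Negative.Core
import Summits.KontsevichZagierPeriods.KontsevichZagierPeriods.Theorems.HurwitzSectorComplement.Negative.Core
import Summits.KontsevichZagierPeriods.KontsevichZagierPeriods.Theorems.HurwitzMicroSectorsNormalFormPrincipleDimOneAssembly
import Summits.KontsevichZagierPeriods.KontsevichZagierPeriods.Theorems.HurwitzMicroSectorsNormalFormPrincipleSplitGlue
import Summits.KontsevichZagierPeriods.KontsevichZagierPeriods.Theorems.HurwitzMicroSectorsNormalFormPrinciplePiBoxResidual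
import Summits.KontsevichZagierPeriods.KontsevichZagierPeriods.Theorems.TerasomaMultiplicationBetaCancellationOfAyoubPiCancellation
import Summits.KontsevichZagierPeriods.KontsevichZagierPeriods.Theorems.VietaFibreKernelFormItemDictionary

/-!
# Crux `NormalFormPrinciple` (stmt-KontsevichZagierPeriods-3869) — strategist census, generation 1
# (scratch certificate; planner-cstrat-stmt-KontsevichZagierPeriods-3869-s1-0, 2026-08-16)

Kernel-checked facts quoted in `STRATEGY-CENSUS.md` (gen 1):

* §A DUAL RESIDUAL INVARIANCE.  Gen 0 proved `Reduction 𝒩 → (Rigidity 𝒩 ↔ summit)`.  Here the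
  other end: for every family `𝒩` that is RIGID and COVERS the values of rational representations,
  `Reduction 𝒩 ↔ summit` (`reductionMod_iff_statement_of_rigid`), and such a family EXISTS
  unconditionally (`exists_rigid_covering`: one rational representative per period value, by choice).
  So "canonical normal forms with trivial rigidity" move the whole summit into the reduction half:
  neither half of the crux can be banked for free.
* §B DIMENSION AXIS.  `ConjDimLe d` = Conjecture 1 for pairs of rational representations of
  dimensions `≤ d`; `ConjDimLe 1` is a THEOREM (lead c4, p124986); the summit is `∀ d, ConjDimLe d`;
  the only finite split along this axis, `ConjDimLe 2 ∧ (∀ d ≥ 2, ConjDimLe d → ConjDimLe (d+1))`,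
  has as second child a statement implied by the summit and implying it back given the first
  (`statement_iff_two_and_step`) — recorded, not filed (no engine for the step: new irreducible
  periods in every dimension).
* §C THE FORMAL SPLIT'S GLUE TYPE.  The landed `normalFormPrincipleSplitGlue_proof` (p111775) has,
  up to `δ`-unfolding of the item constant, exactly the type
  `AyoubPiLocalKernel → AyoubPiCancellation → NormalFormPrinciple` required by `route edit --split
  --glue-by`; and the split is exact (`parent_iff_children`).
* §D A STRENGTHENING WITH STRUCTURE.  `DimBoundedConjecture e`: certificates of dimension overhead
  `≤ e`; implies the summit by closure monotonicity (`statement_of_dimBounded`) — the routine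
  implication the `strengthen` lens demands; the census records why the bound buys no induction.
-/

noncomputable section

open MeasureTheory Set
open Literature.NumberTheory.Transcendental Literature.NumberTheory.Transcendental.KZ

namespace Summit.KontsevichZagierPeriods.HurwitzMicroSectors.NormalFormPrinciple.CensusGen1

open Summit.KontsevichZagierPeriods.KontsevichZagierPeriods.Theses.HurwitzMicroSectors
  (NormalFormPrinciple AyoubPiLocalKernel AyoubPiCancellation NormalFormPrincipleSplitGlue)
open Summit.KontsevichZagierPeriods.HurwitzMicroSectors.NormalFormPrinciple.Negative
  (Family RigidityMod ReductionMod NormalFormPrincipleMod normalFormPrinciple_iff_mod)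
open Summit.KontsevichZagierPeriods.Theorems.HurwitzSectorComplement.Negative (nfp_iff_statement)

variable {n m : ℕ}

/-! ## §A Dual residual invariance -/

/-- A family COVERS if every value of a rational representation is the value of a member. -/
def Covering (𝒩 : Family) : Prop :=
  ∀ (n : ℕ) (r : IntegralRep n), r.IsRational → ∃ (m : ℕ) (N : IntegralRep m), N ∈ 𝒩 m ∧ N.value = r.value

/-- **Dual residual invariance.** For a rigid, covering family the reduction half IS the summit.
[cite: KontsevichZagier2001, §1.2 Conjecture 1] -/
theorem reductionMod_iff_statement_of_rigid (𝒩 : Family) (hrig : RigidityMod relations 𝒩)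
    (hcov : Covering 𝒩) : ReductionMod relations 𝒩 ↔ KontsevichZagierPeriods := by
  constructor
  · intro hred
    exact nfp_iff_statement.mp (normalFormPrinciple_iff_mod.mpr ⟨𝒩, hrig, hred⟩)
  · intro h n r hr
    obtain ⟨m, N, hN, hv⟩ := hcov n r hr
    obtain ⟨k, N', hN'rat, hNN'⟩ := exists_isRational_equivalent_holds N
    have hvN : N.value = N'.value := Equivalent.value_eq_holds hNN'
    have h1 : Equivalent r N' := h r N' hr hN'rat (by rw [← hvN, hv])
    refine ⟨m, N, hN, ?_⟩
    have hsplit : of r - of N = (of r - of N') + -(of N - of N') := by abel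
    rw [hsplit]
    exact relations.add_mem h1 (relations.neg_mem hNN')

/-- **A rigid covering family exists unconditionally**: one rational representative per period
value (axiom of choice). Its rigidity is trivial (equal values ⇒ the same member), so by
`reductionMod_iff_statement_of_rigid` its reduction half is the summit on the nose. [folklore] -/
theorem exists_rigid_covering : ∃ 𝒩 : Family, RigidityMod relations 𝒩 ∧ Covering 𝒩 := by
  classical
  let P : ℝ → Prop := fun x => ∃ s : (Σ k, IntegralRep k), s.2.IsRational ∧ s.2.value = x
  let T : ℝ → Option (Σ k, IntegralRep k) := fun x =>
    if h : P x then some (Classical.choose h) else none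
  refine ⟨fun k => {N | T N.value = some ⟨k, N⟩}, ?_, ?_⟩
  · intro n m N N' hN hN' hv
    have hN1 : T N.value = some ⟨n, N⟩ := hN
    have hN2 : T N'.value = some ⟨m, N'⟩ := hN'
    have hs : (some (⟨n, N⟩ : Σ k, IntegralRep k)) = some ⟨m, N'⟩ := by rw [← hN1, ← hN2, hv]
    simp only [Option.some.injEq] at hs
    obtain ⟨rfl, h2⟩ := Sigma.mk.inj_iff.mp hs
    have h3 : N = N' := eq_of_heq h2
    subst h3
    simp
  · intro n r hr
    have hex : P r.value := ⟨⟨n, r⟩, hr, rfl⟩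
    refine ⟨(Classical.choose hex).1, (Classical.choose hex).2, ?_, (Classical.choose_spec hex).2⟩
    show T (Classical.choose hex).2.value = some ⟨(Classical.choose hex).1, (Classical.choose hex).2⟩
    rw [(Classical.choose_spec hex).2]
    simp only [T, dif_pos hex]

/-- Corollary: the reduction half of the choice family is EQUIVALENT to the summit. [folklore] -/
theorem exists_rigid_covering_reduction_iff_statement :
    ∃ 𝒩 : Family, RigidityMod relations 𝒩 ∧ Covering 𝒩 ∧ (ReductionMod relations 𝒩 ↔ KontsevichZagierPeriods) := by
  obtain ⟨𝒩, hrig, hcov⟩ := exists_rigid_covering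
  exact ⟨𝒩, hrig, hcov, reductionMod_iff_statement_of_rigid 𝒩 hrig hcov⟩

/-- Gen 0's direction, restated for the record: a family that REDUCES has rigidity ⇔ summit. -/
theorem rigidityMod_iff_statement_of_reduction (𝒩 : Family) (hred : ReductionMod relations 𝒩) :
    RigidityMod relations 𝒩 ↔ KontsevichZagierPeriods := by
  constructor
  · intro hrig
    exact nfp_iff_statement.mp (normalFormPrinciple_iff_mod.mpr ⟨𝒩, hrig, hred⟩)
  · intro h n m N N' hN hN' hv
    obtain ⟨k, M, hMrat, hNM⟩ := exists_isRational_equivalent_holds N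
    obtain ⟨k', M', hM'rat, hNM'⟩ := exists_isRational_equivalent_holds N'
    have hvM : M.value = M'.value := by
      rw [← Equivalent.value_eq_holds hNM, ← Equivalent.value_eq_holds hNM', hv]
    exact (hNM.trans (h M M' hMrat hM'rat hvM)).trans hNM'.symm

/-! ## §B The dimension axis -/

/-- Conjecture 1 for pairs of rational representations of dimensions `≤ d`. -/
def ConjDimLe (d : ℕ) : Prop :=
  ∀ ⦃n m : ℕ⦄, n ≤ d → m ≤ d → ∀ (r : IntegralRep n) (r' : IntegralRep m),
    r.IsRational → r'.IsRational → r.value = r'.value → Equivalent r r'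

/-- `d = 1` is a THEOREM (lead c4 of this crux, p124986; Baker). -/
theorem conjDimLe_one : ConjDimLe 1 := fun _ _ hn hm r r' =>
  PiBox.Dlog.kzConjecture_of_dim_le_one hn hm r r'

theorem conjDimLe_anti {d d' : ℕ} (h : d ≤ d') (H : ConjDimLe d') : ConjDimLe d :=
  fun _ _ hn hm r r' => H (hn.trans h) (hm.trans h) r r'

/-- The summit is the conjunction of all layers. -/
theorem statement_iff_forall_conjDimLe : KontsevichZagierPeriods ↔ ∀ d, ConjDimLe d :=
  ⟨fun h _ _ _ _ _ r r' hr hr' hv => h r r' hr hr' hv,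
   fun h n m r r' hr hr' hv => h (max n m) (le_max_left _ _) (le_max_right _ _) r r' hr hr' hv⟩

/-- The inductive step along the dimension axis. -/
def DimStep : Prop := ∀ d, 2 ≤ d → ConjDimLe d → ConjDimLe (d + 1)

/-- The only finite split along this axis: layer 2 and the step. Exact — and the step is implied by
the summit outright, so as a child it is the summit re-indexed unless an ENGINE reduces dimension. -/
theorem statement_iff_two_and_step : KontsevichZagierPeriods ↔ ConjDimLe 2 ∧ DimStep := by
  constructor
  · intro h
    exact ⟨(statement_iff_forall_conjDimLe.mp h) 2, fun d _ _ => (statement_iff_forall_conjDimLe.mp h) (d + 1)⟩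
  · rintro ⟨h2, hstep⟩
    refine statement_iff_forall_conjDimLe.mpr fun d => ?_
    induction d with
    | zero => exact conjDimLe_anti (by norm_num) h2
    | succ d ih =>
      rcases Nat.lt_or_ge d 2 with hd | hd
      · interval_cases d
        · exact conjDimLe_anti (by norm_num) h2
        · exact h2
      · exact hstep d hd ih

/-! ## §C The formal split: glue type and exactness -/

/-- The landed glue theorem has the arrow type `--glue-by` asks for (δ-unfolding only). -/
theorem children_imp_parent : AyoubPiLocalKernel → AyoubPiCancellation → NormalFormPrinciple :=
  NormalFormPrincipleSplitGlue.normalFormPrincipleSplitGlue_proof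

/-- This route's copies of the two children ARE items 0541 / 0540 of route AyoubSpecialisation
(identical bodies: the equivalences are `Iff.rfl`). -/
theorem ayoubPiLocalKernel_iff_item0541 :
    AyoubPiLocalKernel ↔
      Summit.KontsevichZagierPeriods.KontsevichZagierPeriods.Theses.AyoubSpecialisation.AyoubPiLocalKernel :=
  Iff.rfl

theorem ayoubPiCancellation_iff_item0540 :
    AyoubPiCancellation ↔
      Summit.KontsevichZagierPeriods.KontsevichZagierPeriods.Theses.AyoubSpecialisation.AyoubPiCancellation :=
  Iff.rfl

/-- **Exactness of the filed split** in the interface forms of THIS route: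
`NormalFormPrinciple ↔ AyoubPiLocalKernel ∧ AyoubPiCancellation` (residual certificate p103528 +
the landed bridges `ayoubPiLocalKernel_iff_piLocalKernel`, `stub_ayoubBridge`).
[cite: Ayoub2014, Def. 6 and Conj. 7] -/
theorem parent_iff_children : NormalFormPrinciple ↔ AyoubPiLocalKernel ∧ AyoubPiCancellation := by
  rw [PiBox.normalFormPrinciple_iff_piLocalKernel_and_piCancellation, ayoubPiLocalKernel_iff_item0541,
    ayoubPiCancellation_iff_item0540,
    Summit.KontsevichZagierPeriods.KernelForm.LocaliseAtValuePrime.ayoubPiLocalKernel_iff_piLocalKernel,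
    Summit.KontsevichZagierPeriods.KontsevichZagierPeriods.BetaCancellationLine.stub_ayoubBridge]

/-- What remains of the crux once child 2 (π-cancellation, transcendence-free) lands: exactly
child 1. -/
theorem parent_iff_child1_of_child2 (h2 : AyoubPiCancellation) : NormalFormPrinciple ↔ AyoubPiLocalKernel := by
  rw [parent_iff_children]; exact ⟨fun h => h.1, fun h => ⟨h, h2⟩⟩

/-! ## §D A strengthening with structure: dimension-bounded certificates -/

/-- Move instances all of whose representations have dimension `≤ k`. -/
def movesDimLe (k : ℕ) : Set FormalRep :=
  {c | c ∈ domainAddRel ∪ integrandAddRel ∪ changeOfVariablesRel ∪ newtonLeibnizRel ∧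
    ∀ s ∈ FreeAbelianGroup.support c, s.1 ≤ k}

/-- The sub-calculus of certificates living in dimension `≤ k`. -/
def relationsDimLe (k : ℕ) : AddSubgroup FormalRep := AddSubgroup.closure (movesDimLe k)

theorem relationsDimLe_le_relations (k : ℕ) : relationsDimLe k ≤ relations := by
  unfold relationsDimLe relations
  exact AddSubgroup.closure_mono fun c hc => hc.1

/-- **S⁺ (dimension overhead `e`)**: equal-valued rational representations of dimensions `n, m`
are connected by a certificate whose intermediate representations have dimension
`≤ max n m + e`. A STRICT strengthening of Conjecture 1 for every fixed `e`. -/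
def DimBoundedConjecture (e : ℕ) : Prop :=
  ∀ ⦃n m : ℕ⦄ (r : IntegralRep n) (r' : IntegralRep m), r.IsRational → r'.IsRational →
    r.value = r'.value → of r - of r' ∈ relationsDimLe (max n m + e)

/-- `S⁺ ⇒ summit`, routinely (closure monotonicity) — as the `strengthen` lens requires. -/
theorem statement_of_dimBounded (e : ℕ) (h : DimBoundedConjecture e) : KontsevichZagierPeriods :=
  fun _ _ r r' hr hr' hv => relationsDimLe_le_relations _ (h r r' hr hr' hv)

/-- … and hence the crux. -/
theorem normalFormPrinciple_of_dimBounded (e : ℕ) (h : DimBoundedConjecture e) : NormalFormPrinciple :=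
  nfp_iff_statement.mpr (statement_of_dimBounded e h)

end Summit.KontsevichZagierPeriods.HurwitzMicroSectors.NormalFormPrinciple.CensusGen1

end
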